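import Literature.Analysis.FluidPDE.TurbWave0
import HarnessLib

/-!
# Scalar zeroth law over a prescribed carrier — Cesàro bookkeeping

Route-independent real-variable lemmas on the running means `timeMean g T = T⁻¹ ∫₀ᵀ g` and the
long-time averages `longTimeAvgSup` / `longTimeAvgInf` (`TurbWave0`), used by the assembly of
`ScalarZerothLawQuant` (cell `ad-ideate`, planner ad-ideate-p1 ROUND-10 §B3, Steps 1–5):

* `longTimeAvgSup_le_of_forall_pos_eventually_le`, `le_longTimeAvgInf_of_forall_pos_eventually_le`
  — `limsup ≤ c` / `liminf ≥ c` from `ε`-eventual bounds on the running means (plus the one-sided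
  boundedness that rules out the `Real.sSup` junk value);
* `eventually_timeMean_le_add_of_le` — if `g ≤ M` from some time on (and `g` is locally
  integrable), the running means are eventually `≤ M + ε` (Step 1, the energy bound (E));
* `eventually_le_timeMean_of_period_integrals` — if the integrals of a bounded continuous `f`
  over the consecutive periods `[t₁ + nL, t₁ + (n+1)L]` are eventually `≥ c - ε` for every `ε`,
  the running means are eventually `≥ c/L - ε` (Step 5, the floor (D));
* `le_of_ae_le_of_continuousOn_Icc` — an a.e. inequality between functions continuous on `[a,b]`
  holds everywhere on `[a,b]` (Step 2: the energy identity at a.e. time gives the dissipation bound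
  at every time).

Supports stmt-AnomalousDissipation-0448 (prescribed-carrier rung; no statement about Navier–Stokes).
-/

noncomputable section

-- `Summit.<Summit>.<Problem>` is the tree's mandated summit-side namespace (CONVENTIONS §2); for this
-- single-conjunct summit the two coincide, so the duplicate is deliberate.
set_option linter.dupNamespace false

namespace Summit.AnomalousDissipation.AnomalousDissipation.Theorems.ScalarZerothLawKinematic

open MeasureTheory Set Filter Topology
open Literature.Analysis.FluidPDE

/-! ## `limsup` / `liminf` of the running means from `ε`-eventual bounds -/

/-- If the running means are eventually bounded below and, for every `ε > 0`, eventually `≤ c + ε`,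
then `⟨g⟩⁺ = limsup_T T⁻¹∫₀ᵀ g ≤ c`. -/
theorem longTimeAvgSup_le_of_forall_pos_eventually_le {g : ℝ → ℝ} {b c : ℝ}
    (hb : ∀ᶠ T in atTop, b ≤ timeMean g T)
    (h : ∀ ε : ℝ, 0 < ε → ∀ᶠ T in atTop, timeMean g T ≤ c + ε) : longTimeAvgSup g ≤ c := by
  refine le_of_forall_pos_le_add fun ε hε => ?_
  rw [longTimeAvgSup]
  exact limsup_le_of_le (isBoundedUnder_of_eventually_ge hb).isCoboundedUnder_le (h ε hε)

/-- If the running means are eventually bounded above and, for every `ε > 0`, eventually `≥ c - ε`,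
then `c ≤ ⟨g⟩₋ = liminf_T T⁻¹∫₀ᵀ g`. -/
theorem le_longTimeAvgInf_of_forall_pos_eventually_le {g : ℝ → ℝ} {B c : ℝ}
    (hB : ∀ᶠ T in atTop, timeMean g T ≤ B)
    (h : ∀ ε : ℝ, 0 < ε → ∀ᶠ T in atTop, c - ε ≤ timeMean g T) : c ≤ longTimeAvgInf g := by
  rw [longTimeAvgInf]
  have key : ∀ ε : ℝ, 0 < ε → c - ε ≤ liminf (timeMean g) atTop := fun ε hε =>
    le_liminf_of_le (isBoundedUnder_of_eventually_le hB).isCoboundedUnder_ge (h ε hε)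
  have : ∀ ε : ℝ, 0 < ε → c ≤ liminf (timeMean g) atTop + ε := fun ε hε => by
    linarith [key ε hε]
  exact le_of_forall_pos_le_add this

/-! ## Running means of a function bounded from some time on -/

/-- **Late bounds pass to the running means.** If `g` is interval integrable on every `[0,T]` and
`g(t) ≤ M` for all `t ≥ T₁` (`T₁ ≥ 0`), then for every `ε > 0` eventually
`T⁻¹ ∫₀ᵀ g ≤ M + ε` (`∫₀ᵀ g ≤ ∫₀^{T₁} g + (T - T₁) M`). -/
theorem eventually_timeMean_le_add_of_le {g : ℝ → ℝ} {M T₁ : ℝ} (hT₁ : 0 ≤ T₁)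
    (hgi : ∀ T : ℝ, 0 ≤ T → IntervalIntegrable g volume 0 T)
    (hle : ∀ t : ℝ, T₁ ≤ t → g t ≤ M) {ε : ℝ} (hε : 0 < ε) :
    ∀ᶠ T in atTop, timeMean g T ≤ M + ε := by
  set I₁ : ℝ := ∫ t in (0 : ℝ)..T₁, g t with hI₁
  -- `(I₁ - T₁ M)/T → 0`
  have hsmall : ∀ᶠ T : ℝ in atTop, (I₁ - T₁ * M) * T⁻¹ ≤ ε := by
    have h0 : Tendsto (fun T : ℝ => (I₁ - T₁ * M) * T⁻¹) atTop (𝓝 ((I₁ - T₁ * M) * 0)) :=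
      tendsto_inv_atTop_zero.const_mul _
    rw [mul_zero] at h0
    exact (h0.eventually (eventually_le_nhds hε))
  filter_upwards [hsmall, eventually_gt_atTop T₁, eventually_gt_atTop (0 : ℝ)] with T hT hTT₁ hT0
  have hgi₁ : IntervalIntegrable g volume 0 T₁ := hgi T₁ hT₁
  have hgiT : IntervalIntegrable g volume 0 T := hgi T hT0.le
  have hgi₂ : IntervalIntegrable g volume T₁ T := (hgi₁.symm.trans hgiT)
  have hsplit : ∫ t in (0 : ℝ)..T, g t = I₁ + ∫ t in T₁..T, g t :=
    (intervalIntegral.integral_add_adjacent_intervals hgi₁ hgi₂).symm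
  have htail : ∫ t in T₁..T, g t ≤ ∫ _ in T₁..T, M :=
    intervalIntegral.integral_mono_on hTT₁.le hgi₂ (continuous_const.intervalIntegrable _ _)
      fun t ht => hle t ht.1
  rw [intervalIntegral.integral_const, smul_eq_mul] at htail
  rw [timeMean, hsplit]
  have hTinv : 0 < T⁻¹ := inv_pos.2 hT0
  calc T⁻¹ * (I₁ + ∫ t in T₁..T, g t) ≤ T⁻¹ * (I₁ + (T - T₁) * M) := by
        exact mul_le_mul_of_nonneg_left (by linarith) hTinv.le
    _ = M + (I₁ - T₁ * M) * T⁻¹ := by field_simp; ring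
    _ ≤ M + ε := by linarith

/-! ## Running means from lower bounds on period integrals -/

/-- **Period integrals pass to the running means.** Let `f` be continuous on `[0,∞)` with
`|f| ≤ M` there, `t₁ ≥ 0`, `L > 0`, and suppose that for every `ε > 0` the integrals of `f` over
the consecutive periods `[t₁ + nL, t₁ + (n+1)L]` are `≥ c - ε` for all large `n`. Then for every
`ε > 0`, eventually `T⁻¹ ∫₀ᵀ f ≥ c/L - ε` (decompose `[0,T]` into `[0,t₁]`, `⌊(T-t₁)/L⌋` full
periods and a remainder shorter than `L`; the two end pieces and the first `N₀` periods cost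
`O(1)`). -/
theorem eventually_le_timeMean_of_period_integrals {f : ℝ → ℝ} {M t₁ L c : ℝ}
    (hf : ContinuousOn f (Ici 0)) (hM : ∀ t : ℝ, 0 ≤ t → |f t| ≤ M) (ht₁ : 0 ≤ t₁) (hL : 0 < L)
    (hP : ∀ ε : ℝ, 0 < ε → ∃ N₀ : ℕ, ∀ n : ℕ, N₀ ≤ n →
      c - ε ≤ ∫ t in (t₁ + n * L)..(t₁ + (n + 1) * L), f t)
    {ε : ℝ} (hε : 0 < ε) :
    ∀ᶠ T in atTop, c / L - ε ≤ timeMean f T := by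
  have hM0 : 0 ≤ M := (abs_nonneg _).trans (hM 0 le_rfl)
  -- interval integrability on subintervals of `[0,∞)`
  have hii : ∀ a b : ℝ, 0 ≤ a → 0 ≤ b → IntervalIntegrable f volume a b := by
    intro a b ha hb
    refine (hf.mono ?_).intervalIntegrable
    intro t ht
    simp only [mem_Ici]
    rcases le_total a b with hab | hab
    · rw [uIcc_of_le hab] at ht; exact ha.trans ht.1
    · rw [uIcc_of_ge hab] at ht; exact hb.trans ht.1
  -- bound on any piece `[a, b] ⊆ [0,∞)` of length `≤ ℓ`: `|∫ₐᵇ f| ≤ M ℓ`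
  have hpiece : ∀ a b : ℝ, 0 ≤ a → a ≤ b → |∫ t in a..b, f t| ≤ M * (b - a) := by
    intro a b ha hab
    have h := intervalIntegral.norm_integral_le_of_norm_le_const (a := a) (b := b) (C := M)
      (f := f) ?_
    · rw [Real.norm_eq_abs, abs_of_nonneg (sub_nonneg.2 hab)] at h
      exact h
    · intro t ht
      rw [uIoc_of_le hab] at ht
      rw [Real.norm_eq_abs]
      exact hM t (ha.trans ht.1.le)
  -- the period integrals and the `ε/2`-threshold
  set P : ℕ → ℝ := fun n => ∫ t in (t₁ + n * L)..(t₁ + (n + 1) * L), f t with hPdef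
  have hε2 : 0 < ε * L / 2 := by positivity
  obtain ⟨N₀, hN₀⟩ := hP (ε * L / 2) hε2
  set c' : ℝ := c - ε * L / 2 with hc'
  -- every period integral is `≥ c' - D` with `D = (|c'| + M L) · 𝟙_{n < N₀}`; summed: `≥ N c' - N₀ (|c'| + ML)`
  have hPall : ∀ n : ℕ, -(M * L) ≤ P n := by
    intro n
    have h := hpiece (t₁ + n * L) (t₁ + (n + 1) * L) (by positivity) (by nlinarith)
    have e : t₁ + (n + 1) * L - (t₁ + n * L) = L := by ring
    rw [e] at h
    have := neg_abs_le (P n)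
    linarith
  have hsum : ∀ N : ℕ, (N : ℝ) * c' - N₀ * (|c'| + M * L) ≤ ∑ n ∈ Finset.range N, P n := by
    intro N
    have hterm : ∀ n ∈ Finset.range N,
        c' - (if n < N₀ then |c'| + M * L else 0) ≤ P n := by
      intro n _
      split_ifs with hn
      · have := hPall n
        have := le_abs_self c'
        linarith
      · simp only [sub_zero]
        exact hN₀ n (not_lt.1 hn)
    have h1 := Finset.sum_le_sum hterm
    rw [Finset.sum_sub_distrib, Finset.sum_const, Finset.card_range, nsmul_eq_mul] at h1
    have h2 : ∑ n ∈ Finset.range N, (if n < N₀ then |c'| + M * L else 0) ≤ N₀ * (|c'| + M * L) := by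
      rw [Finset.sum_ite, Finset.sum_const_zero, add_zero, Finset.sum_const, nsmul_eq_mul]
      refine mul_le_mul_of_nonneg_right ?_ (by positivity)
      have : (Finset.filter (fun n => n < N₀) (Finset.range N)).card ≤ N₀ := by
        calc (Finset.filter (fun n => n < N₀) (Finset.range N)).card
            ≤ (Finset.range N₀).card := Finset.card_le_card fun n hn => by
                simp only [Finset.mem_filter, Finset.mem_range] at hn ⊢; exact hn.2
          _ = N₀ := Finset.card_range N₀
      exact_mod_cast this
    linarith
  -- the constant absorbing all the `O(1)` pieces
  set K : ℝ := N₀ * (|c'| + M * L) + M * t₁ + M * L + |c'| + |c'| * (t₁ / L) with hK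
  have hK0 : 0 ≤ K := by positivity
  -- for `T ≥ t₁ + L`: `∫₀ᵀ f ≥ (T/L) c' - K`
  have hlow : ∀ T : ℝ, t₁ + L ≤ T → T / L * c' - K ≤ ∫ t in (0 : ℝ)..T, f t := by
    intro T hT
    have hTt₁ : t₁ ≤ T := by linarith
    set N : ℕ := ⌊(T - t₁) / L⌋₊ with hN
    have hx0 : 0 ≤ (T - t₁) / L := div_nonneg (by linarith) hL.le
    have hNle : (N : ℝ) ≤ (T - t₁) / L := Nat.floor_le hx0
    have hNgt : (T - t₁) / L < N + 1 := Nat.lt_floor_add_one _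
    have hNL : t₁ + N * L ≤ T := by
      have : (N : ℝ) * L ≤ T - t₁ := by rwa [le_div_iff₀ hL] at hNle
      linarith
    have hrem : T - (t₁ + N * L) ≤ L := by
      have : T - t₁ < (N + 1) * L := by rwa [div_lt_iff₀ hL] at hNgt
      linarith
    -- decomposition of `∫₀ᵀ`
    have hmid : ∑ n ∈ Finset.range N, P n = ∫ t in t₁..(t₁ + N * L), f t := by
      have := intervalIntegral.sum_integral_adjacent_intervals (a := fun n : ℕ => t₁ + n * L) (μ := volume)
        (f := f) (n := N) fun k _ => hii _ _ (by positivity) (by positivity)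
      simp only [Nat.cast_zero, zero_mul, add_zero] at this
      rw [← this]
      refine Finset.sum_congr rfl fun n _ => ?_
      simp only [hPdef, Nat.cast_add, Nat.cast_one]
    have hdec : ∫ t in (0 : ℝ)..T, f t =
        (∫ t in (0 : ℝ)..t₁, f t) + (∑ n ∈ Finset.range N, P n) + ∫ t in (t₁ + N * L)..T, f t := by
      rw [hmid, intervalIntegral.integral_add_adjacent_intervals (hii _ _ le_rfl ht₁)
        (hii _ _ ht₁ (by positivity)),
        intervalIntegral.integral_add_adjacent_intervals (hii _ _ le_rfl (by positivity))
        (hii _ _ (by positivity) (by linarith))]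
    have h1 : -(M * t₁) ≤ ∫ t in (0 : ℝ)..t₁, f t := by
      have h := hpiece 0 t₁ le_rfl ht₁
      rw [sub_zero] at h
      have := neg_abs_le (∫ t in (0 : ℝ)..t₁, f t)
      linarith
    have h3 : -(M * L) ≤ ∫ t in (t₁ + N * L)..T, f t := by
      have h := hpiece (t₁ + N * L) T (by positivity) hNL
      have := neg_abs_le (∫ t in (t₁ + N * L)..T, f t)
      nlinarith
    have h2 := hsum N
    -- `N c' ≥ (T - t₁)/L · c' - |c'|`, whatever the sign of `c'`
    have hNc : (T - t₁) / L * c' - |c'| ≤ (N : ℝ) * c' := by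
      rcases le_or_gt 0 c' with hc0 | hc0
      · have : ((T - t₁) / L - 1) * c' ≤ (N : ℝ) * c' :=
          mul_le_mul_of_nonneg_right (by linarith) hc0
        rw [abs_of_nonneg hc0]; linarith
      · have : (T - t₁) / L * c' ≤ (N : ℝ) * c' := mul_le_mul_of_nonpos_right hNle hc0.le
        have := abs_nonneg c'
        linarith
    have ht₁c : t₁ / L * c' ≤ t₁ / L * |c'| :=
      mul_le_mul_of_nonneg_left (le_abs_self c') (div_nonneg ht₁ hL.le)
    rw [hdec, hK]
    have e : T / L * c' = (T - t₁) / L * c' + t₁ / L * c' := by ring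
    rw [e]
    linarith
  -- conclusion: `timeMean f T ≥ c'/L - K/T ≥ c/L - ε` for `T` large
  have hsmall : ∀ᶠ T : ℝ in atTop, K * T⁻¹ ≤ ε / 2 := by
    have h0 : Tendsto (fun T : ℝ => K * T⁻¹) atTop (𝓝 (K * 0)) := tendsto_inv_atTop_zero.const_mul _
    rw [mul_zero] at h0
    exact h0.eventually (eventually_le_nhds (by positivity))
  filter_upwards [hsmall, eventually_ge_atTop (t₁ + L), eventually_gt_atTop (0 : ℝ)] with T hT hTL hT0
  have h := hlow T hTL
  rw [timeMean]
  have hTinv : 0 < T⁻¹ := inv_pos.2 hT0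
  have e1 : T⁻¹ * (T / L * c' - K) = c' / L - K * T⁻¹ := by field_simp
  calc c / L - ε = c' / L + (ε / 2 - ε) := by rw [hc']; field_simp; ring
    _ ≤ c' / L - K * T⁻¹ := by linarith
    _ = T⁻¹ * (T / L * c' - K) := e1.symm
    _ ≤ T⁻¹ * ∫ t in (0 : ℝ)..T, f t := mul_le_mul_of_nonneg_left h hTinv.le

/-! ## A.e. inequalities between continuous functions -/

/-- Two functions continuous on `[a,b]` (`a < b`) with `F ≤ G` a.e. on `[a,b]` satisfy `F ≤ G`
everywhere on `[a,b]` (apply `Measure.eqOn_Icc_of_ae_eq` to `max (F - G) 0` and `0`). -/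
theorem le_of_ae_le_of_continuousOn_Icc {F G : ℝ → ℝ} {a b : ℝ} (hab : a < b)
    (hF : ContinuousOn F (Icc a b)) (hG : ContinuousOn G (Icc a b))
    (h : ∀ᵐ t ∂(volume.restrict (Icc a b)), F t ≤ G t) : ∀ t ∈ Icc a b, F t ≤ G t := by
  have hc : ContinuousOn (fun t => max (F t - G t) 0) (Icc a b) :=
    (continuous_id.max continuous_const).comp_continuousOn (hF.sub hG)
  have hae : (fun t => max (F t - G t) 0) =ᵐ[volume.restrict (Icc a b)] fun _ => (0 : ℝ) := by
    filter_upwards [h] with t ht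
    exact max_eq_right (by linarith)
  have heq := Measure.eqOn_Icc_of_ae_eq (μ := volume) hab.ne hae hc continuousOn_const
  intro t ht
  have := heq ht
  simp only at this
  have h1 : F t - G t ≤ 0 := by
    have := le_max_left (F t - G t) 0
    rw [‹max (F t - G t) 0 = 0›] at this
    exact this
  linarith

end Summit.AnomalousDissipation.AnomalousDissipation.Theorems.ScalarZerothLawKinematic

end
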